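import Summits.RiemannHypothesis.RiemannHypothesis.Theorems.SpectralTraceSpectralThesisStubDensityAux2
import Summits.RiemannHypothesis.RiemannHypothesis.Theorems.SpectralTraceSpectralThesisStubDensityAux3
import HarnessLib

/-!
# Crux `SpectralThesis` (stmt-RiemannHypothesis-0187), line `Sketch` — stub `stub_density`

From the Fourier-kernel toolkit (the hypothesis, = statement of `stub_kernelToolkit`): for every
`0 < A ≤ 1/2` a `C²` density `ν_A` on the `t`-side with
`log(1/A)/2π − C₁ ≤ ν_A(t) ≤ log(1/A)/2π + C₁(1+|t|)`, `|ν_A'|, |ν_A''| ≤ C₂` (constants independent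
of `A`) and `∫ ĝ(t) ν_A(t) dt = W(g)` for every Weil test `g` supported in `[-A, A]`.

Construction: `χ` the bump `ContDiffBump ⟨1, 2⟩` at `0`, `K` its kernel, `σ_c = 2cosh(x/2)χ(x)` with
kernel `K_c`, `ℓ(s) = log(1+s²)/(4π)`, `b = θ'/π + K_c − ℓ` (bounded, by the first-order Stirling
bound `abs_riemannSiegelThetaDeriv_sub_log_le`), and
`ν_A(t) = ∫ K(u) ℓ(t − u/A) du + A ∫ K(A(t−s)) b(s) ds = (q_A ∗ (θ'/π + K_c))(t)`, `q_A(x) = A K(Ax)`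
the kernel of `χ(·/A)` (`Density.scale_density`, file `…StubDensityAux3`). The `W`-identity is
Fubini (`Density.integral_mul_conv_swap`) + the reproducing identities of the toolkit +
`Density.weil_value` (file `…StubDensityAux2`).
-/

noncomputable section

set_option linter.dupNamespace false
set_option autoImplicit false

open Complex Set MeasureTheory Filter
open scoped Real ContDiff Topology

namespace Summit.RiemannHypothesis.RiemannHypothesis.Theorems.SpectralThesis.Sketch

open Literature.NumberTheory.LFunctions

/-- **Stub `stub_density`** (line `Sketch`, crux `SpectralThesis`): from the Fourier-kernel toolkit,
for every `0 < A ≤ 1/2` a `C²` density `ν_A` with `log(1/A)/2π − C₁ ≤ ν_A ≤ log(1/A)/2π + C₁(1+|t|)`,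
`|ν_A'|, |ν_A''| ≤ C₂`, and `∫ ĝ ν_A = W(g)` for every Weil test `g` supported in `[-A, A]`.
Construction `ν_A = q_A ∗ (θ'/π + K_c)` written as `∫ K(u) ℓ(t − u/A) du + A ∫ K(A(t−s)) b(s) ds`,
`ℓ = log(1+s²)/(4π)`, `b = θ'/π + K_c − ℓ` bounded; see the module docstring. [folklore] -/
theorem stub_density :
    ((∀ σ : ℝ → ℝ, ContDiff ℝ ∞ σ → HasCompactSupport σ → (∀ x, σ (-x) = σ x) →
      ∃ (K dK ddK : ℝ → ℝ) (C : ℝ),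
        (∀ t, K t = 1 / (2 * π) * ∫ x, σ x * Real.cos (t * x)) ∧
        (∀ t, HasDerivAt K (dK t) t) ∧ (∀ t, HasDerivAt dK (ddK t) t) ∧ Continuous ddK ∧
        (∀ t, K (-t) = K t) ∧
        (∀ t, |K t| ≤ C / (1 + t ^ 2)) ∧ (∀ t, |dK t| ≤ C / (1 + t ^ 2)) ∧
        (∀ t, |ddK t| ≤ C / (1 + t ^ 2)) ∧
        (∀ x, (∫ t, K t * Real.cos (t * x)) = σ x) ∧
        (∀ A : ℝ, 0 < A → ∀ t, (1 / (2 * π) * ∫ x, σ (x / A) * Real.cos (t * x)) = A * K (A * t)) ∧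
        (∀ g : ℝ → ℂ, Continuous g → HasCompactSupport g →
          (∀ t : ℝ, (∫ s, (K (t - s) : ℂ) * weilMellin g (1 / 2 + (s : ℂ) * I)) =
              weilMellin (fun x => (σ x : ℂ) * g x) (1 / 2 + (t : ℂ) * I)) ∧
          (∫ t : ℝ, weilMellin g (1 / 2 + (t : ℂ) * I) * (K t : ℂ)) = ∫ x, g x * (σ x : ℂ))) ∧
    (∀ g : ℝ → ℂ, IsWeilTest g →
      (∀ t : ℝ, HasDerivAt (fun s : ℝ => weilMellin g (1 / 2 + (s : ℂ) * I))
          (weilMellin (fun x : ℝ => I * (x : ℂ) * g x) (1 / 2 + (t : ℂ) * I)) t) ∧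
      IsWeilTest (fun x : ℝ => I * (x : ℂ) * g x) ∧
      tsupport (fun x : ℝ => I * (x : ℂ) * g x) ⊆ tsupport g ∧
      ∃ C : ℝ, ∀ t : ℝ, ‖weilMellin g (1 / 2 + (t : ℂ) * I)‖ ≤ C / (1 + t ^ 2) ^ 2)) →
    ∃ C₁ C₂ : ℝ, 0 ≤ C₁ ∧ 0 ≤ C₂ ∧ ∀ A : ℝ, 0 < A → A ≤ 1 / 2 →
      ∃ ν dν ddν : ℝ → ℝ,
        (∀ t, HasDerivAt ν (dν t) t) ∧ (∀ t, HasDerivAt dν (ddν t) t) ∧ Continuous ddν ∧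
        (∀ t, Real.log (1 / A) / (2 * π) - C₁ ≤ ν t) ∧
        (∀ t, ν t ≤ Real.log (1 / A) / (2 * π) + C₁ * (1 + |t|)) ∧
        (∀ t, |dν t| ≤ C₂) ∧ (∀ t, |ddν t| ≤ C₂) ∧
        (∀ g : ℝ → ℂ, IsWeilTest g → tsupport g ⊆ Set.Icc (-A) A →
          Integrable (fun t : ℝ => weilMellin g (1 / 2 + (t : ℂ) * I) * (ν t : ℂ)) ∧
          (∫ t : ℝ, weilMellin g (1 / 2 + (t : ℂ) * I) * (ν t : ℂ)) = weilFunctional g) := by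
  rintro ⟨hK, hT⟩
  /- the plateau `χ` -/
  let bump : ContDiffBump (0 : ℝ) := ⟨1, 2, one_pos, one_lt_two⟩
  obtain ⟨χ, hχdef⟩ : ∃ χ : ℝ → ℝ, χ = fun x => bump x := ⟨_, rfl⟩
  have hχ_smooth : ContDiff ℝ ∞ χ := hχdef ▸ bump.contDiff
  have hχ_cpt : HasCompactSupport χ := hχdef ▸ bump.hasCompactSupport
  have hχ_even : ∀ x, χ (-x) = χ x := fun x => by rw [hχdef]; exact bump.neg x
  have hχ_one : ∀ x : ℝ, |x| ≤ 1 → χ x = 1 := fun x hx => by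
    rw [hχdef]
    exact bump.one_of_mem_closedBall (by simpa [Metric.mem_closedBall, Real.dist_eq] using hx)
  have hχ_zero : ∀ x : ℝ, 2 ≤ |x| → χ x = 0 := fun x hx => by
    rw [hχdef]
    exact bump.zero_of_le_dist (by simpa [Real.dist_eq] using hx)
  /- the kernel `K` of `χ` -/
  obtain ⟨K, dK, ddK, C, -, hKd, hdKd, hddKc, -, hKb, hdKb, hddKb, hKinv, hKdil, -⟩ :=
    hK χ hχ_smooth hχ_cpt hχ_even
  have hC : 0 ≤ C := by
    have := (abs_nonneg _).trans (hKb 0); simpa using this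
  have hK_cont : Continuous K := continuous_iff_continuousAt.2 fun t => (hKd t).continuousAt
  have hK_one : ∫ u, K u = 1 := by
    have h := hKinv 0
    simp only [mul_zero, Real.cos_zero, mul_one] at h
    rw [h]
    exact hχ_one 0 (by simp)
  /- the polar symbol `σ_c = 2 cosh(x/2) χ(x)` and its kernel `K_c` -/
  obtain ⟨σc, hσcdef⟩ : ∃ σc : ℝ → ℝ, σc = fun x => 2 * Real.cosh (x / 2) * χ x := ⟨_, rfl⟩
  have hσc_smooth : ContDiff ℝ ∞ σc :=
    hσcdef ▸ (contDiff_const.mul (Real.contDiff_cosh.comp (contDiff_id.div_const 2))).mul hχ_smooth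
  have hσc_cpt : HasCompactSupport σc := hσcdef ▸ hχ_cpt.mul_left
  have hσc_even : ∀ x, σc (-x) = σc x := fun x => by
    simp only [hσcdef, neg_div, Real.cosh_neg, hχ_even]
  have hσc_one : ∀ x, |x| ≤ 1 → σc x = Real.exp (x / 2) + Real.exp (-(x / 2)) := fun x hx => by
    simp only [hσcdef, hχ_one x hx, Real.cosh_eq]; ring
  obtain ⟨Kc, dKc, -, Cc, -, hKcd, -, -, -, hKcb, -, -, -, -, hKcrep⟩ :=
    hK σc hσc_smooth hσc_cpt hσc_even
  have hKc_cont : Continuous Kc := continuous_iff_continuousAt.2 fun t => (hKcd t).continuousAt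
  have hCc : 0 ≤ Cc := by
    have := (abs_nonneg _).trans (hKcb 0); simpa using this
  /- the bounded part `b = θ'/π + K_c − ℓ`, `ℓ = log(1+s²)/(4π)` -/
  obtain ⟨B₀, hB₀⟩ := Density.thetaDeriv_sub_log_bounded
  obtain ⟨b, hbdef⟩ : ∃ b : ℝ → ℝ,
    b = fun s => riemannSiegelThetaDeriv s / π + Kc s - Real.log (1 + s ^ 2) / (4 * π) := ⟨_, rfl⟩
  have hb_cont : Continuous b := by
    rw [hbdef]
    refine ((continuous_riemannSiegelThetaDeriv_holds.div_const π).add hKc_cont).sub ?_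
    exact continuous_iff_continuousAt.2 fun s => (Density.hasDerivAt_ell s).continuousAt
  have hbB : ∀ s, |b s| ≤ B₀ + Cc := fun s => by
    have h3 : |Kc s| ≤ Cc := (hKcb s).trans (div_le_self hCc (by nlinarith))
    have e : b s = (riemannSiegelThetaDeriv s / π - Real.log (1 + s ^ 2) / (4 * π)) + Kc s := by
      rw [hbdef]; ring
    rw [e]
    exact (abs_add_le _ _).trans (add_le_add (hB₀ s) h3)
  set B : ℝ := B₀ + Cc with hBdef
  have hBn : 0 ≤ B := (abs_nonneg _).trans (hbB 0)
  /- the log-smoothing constant and the constants `C₁, C₂` -/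
  obtain ⟨M, hM0, hM⟩ := Density.log_smoothing hK_cont hKb
  have hπ3 := Real.pi_gt_three
  refine ⟨M / (4 * π) + C * B * π + 1, C * 1 * π + C * B * π, by positivity, by positivity,
    fun A hA hA2 => ?_⟩
  have hA1 : A ≤ 1 := by linarith
  obtain ⟨ν, dν, ddν, hνd, hdνd, hddνc, hνM, hdνb, hddνb, hνrep⟩ :=
    Density.scale_density hKd hdKd hddKc hKb hdKb hddKb hK_one hb_cont hbB hM hA hA1
  /- size of `ν` -/
  have hνlow : ∀ t, Real.log (1 / A) / (2 * π) - (M / (4 * π) + C * B * π + 1) ≤ ν t := fun t => by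
    have h1 := (abs_le.1 (hνM t)).1
    have hlog : 0 ≤ Real.log (1 + (A * t) ^ 2) / (4 * π) :=
      div_nonneg (Real.log_nonneg (by nlinarith [sq_nonneg (A * t)])) (by positivity)
    linarith
  have hνup : ∀ t, ν t ≤ Real.log (1 / A) / (2 * π) + (M / (4 * π) + C * B * π + 1) * (1 + |t|) :=
    fun t => by
    have h1 := (abs_le.1 (hνM t)).2
    have hlog : Real.log (1 + (A * t) ^ 2) / (4 * π) ≤ |t| := by
      rw [div_le_iff₀ (by positivity)]
      have hAt : |A * t| ≤ |t| := by
        rw [abs_mul, abs_of_pos hA]; exact mul_le_of_le_one_left (abs_nonneg t) hA1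
      have h5 : 1 + (A * t) ^ 2 ≤ (1 + |A * t|) ^ 2 := by
        rw [← sq_abs (A * t)]; nlinarith [abs_nonneg (A * t)]
      have h6 : Real.log (1 + (A * t) ^ 2) ≤ 2 * |A * t| := by
        calc Real.log (1 + (A * t) ^ 2) ≤ Real.log ((1 + |A * t|) ^ 2) :=
              Real.log_le_log (by positivity) h5
          _ = 2 * Real.log (1 + |A * t|) := by rw [Real.log_pow]; push_cast; ring
          _ ≤ 2 * |A * t| := by
              have := Real.log_le_sub_one_of_pos (by positivity : (0 : ℝ) < 1 + |A * t|)
              linarith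
      have h7 : 2 * |t| ≤ |t| * (4 * π) := by nlinarith [abs_nonneg t]
      linarith
    have h0 : 0 ≤ M / (4 * π) + C * B * π := by positivity
    have h5 : |t| ≤ (M / (4 * π) + C * B * π + 1) * |t| :=
      le_mul_of_one_le_left (abs_nonneg t) (by linarith)
    have e : (M / (4 * π) + C * B * π + 1) * (1 + |t|) =
        (M / (4 * π) + C * B * π + 1) + (M / (4 * π) + C * B * π + 1) * |t| := by ring
    rw [e]
    linarith
  refine ⟨ν, dν, ddν, hνd, hdνd, hddνc, hνlow, hνup, hdνb, hddνb, fun g hg hsupp => ?_⟩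
  /- integrability of `ĝ ν` -/
  obtain ⟨hĝd, -, -, Cg, hĝb⟩ := hT g hg
  have hĝc : Continuous fun s : ℝ => weilMellin g (1 / 2 + (s : ℂ) * I) :=
    continuous_iff_continuousAt.2 fun t => (hĝd t).continuousAt
  have hνc : Continuous ν := continuous_iff_continuousAt.2 fun t => (hνd t).continuousAt
  have hνabs : ∀ t, |ν t| ≤ (|Real.log (1 / A)| / (2 * π) + 1 + (M / (4 * π) + C * B * π)) *
      (1 + t ^ 2) := fun t => by
    have h1 := abs_le.1 (hνM t)
    set L2 : ℝ := |Real.log (1 / A)| / (2 * π) with hL2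
    set T : ℝ := 1 + t ^ 2 with hT
    set E : ℝ := M / (4 * π) + C * B * π with hE
    have hT1 : 1 ≤ T := by rw [hT]; nlinarith [sq_nonneg t]
    have hL2n : 0 ≤ L2 := by positivity
    have hEn : 0 ≤ E := by positivity
    have h8 : Real.log (1 / A) / (2 * π) ≤ L2 :=
      div_le_div_of_nonneg_right (le_abs_self _) (by positivity)
    have h9 : -L2 ≤ Real.log (1 / A) / (2 * π) := by
      rw [hL2, ← neg_div]; exact div_le_div_of_nonneg_right (neg_abs_le _) (by positivity)
    have hlpos : 0 ≤ Real.log (1 + (A * t) ^ 2) := Real.log_nonneg (by nlinarith [sq_nonneg (A * t)])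
    have hlog0 : 0 ≤ Real.log (1 + (A * t) ^ 2) / (4 * π) := div_nonneg hlpos (by positivity)
    have hlog1 : Real.log (1 + (A * t) ^ 2) / (4 * π) ≤ T := by
      have h2 : Real.log (1 + (A * t) ^ 2) ≤ (A * t) ^ 2 := by
        have := Real.log_le_sub_one_of_pos (by positivity : (0 : ℝ) < 1 + (A * t) ^ 2); linarith
      have h3 : (A * t) ^ 2 ≤ T := by
        rw [hT, mul_pow]
        nlinarith [mul_le_mul_of_nonneg_right (show A ^ 2 ≤ 1 by nlinarith) (sq_nonneg t)]
      have h5 : Real.log (1 + (A * t) ^ 2) / (4 * π) ≤ Real.log (1 + (A * t) ^ 2) :=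
        div_le_self hlpos (by linarith)
      linarith
    have h7 : L2 ≤ L2 * T := le_mul_of_one_le_right hL2n hT1
    have h12 : E ≤ E * T := le_mul_of_one_le_right hEn hT1
    have e : (L2 + 1 + E) * T = L2 * T + T + E * T := by ring
    rw [abs_le, e]
    constructor <;> linarith
  have hint : Integrable (fun t : ℝ => weilMellin g (1 / 2 + (t : ℂ) * I) * (ν t : ℂ)) :=
    Density.integrable_mul_of_decay hĝc hĝb hνc hνabs
  refine ⟨hint, ?_⟩
  /- the `W`-identity: `ν = q_A ∗ w₀`, `w₀ = ℓ + b = θ'/π + K_c` -/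
  obtain ⟨w₀, hw₀def⟩ : ∃ w₀ : ℝ → ℝ,
    w₀ = fun s => Real.log (1 + s ^ 2) / (4 * π) + b s := ⟨_, rfl⟩
  have hw₀pt : ∀ s, w₀ s = Real.log (1 + s ^ 2) / (4 * π) + b s := fun s => by rw [hw₀def]
  have hw₀c : Continuous w₀ := by
    rw [hw₀def]
    exact (continuous_iff_continuousAt.2 fun s => (Density.hasDerivAt_ell s).continuousAt).add
      hb_cont
  have hw₀ : ∀ s, w₀ s = riemannSiegelThetaDeriv s / π + Kc s := fun s => by
    rw [hw₀pt, hbdef]; ring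
  have hw₀b : ∀ s, |w₀ s| ≤ B + Real.log (1 + s ^ 2) := fun s => by
    have h1 := Density.abs_ell_le s
    have h2 := hbB s
    rw [hw₀pt]
    refine (abs_add_le _ _).trans ?_
    linarith
  have hw₀b' : ∀ s, |w₀ s| ≤ (B + 1) * (1 + s ^ 2) := fun s => by
    refine (hw₀b s).trans ?_
    have h1 : Real.log (1 + s ^ 2) ≤ 1 + s ^ 2 := by
      have := Real.log_le_sub_one_of_pos (by positivity : (0 : ℝ) < 1 + s ^ 2); linarith
    have h2 : 0 ≤ B * s ^ 2 := mul_nonneg hBn (sq_nonneg s)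
    have e : (B + 1) * (1 + s ^ 2) = B + B * s ^ 2 + (1 + s ^ 2) := by ring
    rw [e]; linarith
  -- the dilated plateau and its kernel `q_A = A K(A·)`
  obtain ⟨χA, hχAdef⟩ : ∃ χA : ℝ → ℝ, χA = fun x => χ (x / A) := ⟨_, rfl⟩
  have hχApt : ∀ x, χA x = χ (x / A) := fun x => by rw [hχAdef]
  have hχA_smooth : ContDiff ℝ ∞ χA := by
    rw [hχAdef]; exact hχ_smooth.comp (contDiff_id.div_const A)
  have hχA_cpt : HasCompactSupport χA := by
    refine HasCompactSupport.intro (isCompact_Icc (a := -(2 * A)) (b := 2 * A)) fun x hx => ?_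
    rw [hχApt]
    apply hχ_zero
    rw [abs_div, abs_of_pos hA, le_div_iff₀ hA]
    simp only [mem_Icc, not_and_or, not_le] at hx
    rcases hx with h | h
    · rw [abs_of_neg (by linarith)]; linarith
    · rw [abs_of_pos (by linarith)]; linarith
  have hχA_even : ∀ x, χA (-x) = χA x := fun x => by rw [hχApt, hχApt, neg_div, hχ_even]
  obtain ⟨q, dq, -, Cq, hqdef, hqd, -, -, hqeven, -, -, -, -, -, hqrep⟩ :=
    hK χA hχA_smooth hχA_cpt hχA_even
  have hq_cont : Continuous q := continuous_iff_continuousAt.2 fun t => (hqd t).continuousAt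
  have hqK : ∀ x, q x = A * K (A * x) := fun x => by
    rw [hqdef x, ← hKdil A hA x]
    simp only [hχApt]
  have hqb : ∀ x, |q x| ≤ A * C / (1 + (A * x) ^ 2) := fun x => by
    rw [hqK, abs_mul, abs_of_pos hA, mul_div_assoc]
    exact mul_le_mul_of_nonneg_left (hKb _) hA.le
  -- `ν t = ∫ q(t − s) w₀(s) ds`
  have hνconv : ∀ t, ν t = ∫ s, q (t - s) * w₀ s := by
    intro t
    have e1 : (∫ s, q (t - s) * w₀ s) = A * ∫ s, K (A * (t - s)) * w₀ s := by
      rw [← integral_const_mul]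
      congr 1 with s
      rw [hqK]; ring
    rw [e1, Density.dilate_subst K w₀ hA t, hνrep t]
    congr 1 with u
    rw [hw₀pt]
  -- `χ_A g = g`
  have hχAg : (fun x => ((χA x : ℝ) : ℂ) * g x) = g := by
    funext x
    by_cases hx : g x = 0
    · simp [hx]
    · have hxs : x ∈ Icc (-A) A := hsupp (subset_tsupport g (Function.mem_support.2 hx))
      have h1 : |x / A| ≤ 1 := by
        rw [abs_div, abs_of_pos hA, div_le_one hA, abs_le]
        exact ⟨hxs.1, hxs.2⟩
      have : χA x = 1 := (hχApt x).trans (hχ_one _ h1)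
      rw [this]; simp
  have hstep : (∫ t : ℝ, weilMellin g (1 / 2 + (t : ℂ) * I) * (ν t : ℂ)) =
      ∫ s : ℝ, weilMellin g (1 / 2 + (s : ℂ) * I) * (w₀ s : ℂ) := by
    simp_rw [hνconv]
    rw [Density.integral_mul_conv_swap hĝc hĝb hq_cont hA hA1 hqb hqeven hw₀c hw₀b]
    congr 1 with s
    rw [(hqrep g hg.1.continuous hg.2).1 s, hχAg]
  rw [hstep]
  exact Density.weil_value hg hA2 hsupp hĝc hĝb hσc_one hKc_cont hKcb
    (hKcrep g hg.1.continuous hg.2).2 hw₀ hw₀b'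

end Summit.RiemannHypothesis.RiemannHypothesis.Theorems.SpectralThesis.Sketch

end
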